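import Summits.QuantumFields.YangMills.Theorems.IR.EsPolymerPeierlsTailK
import Literature.Probability.LatticeModels.LocalPerturbationClusterExpansion

/-!
# Crux `IR` (item stmt-QuantumFields-19354) — line «es-polymer-decoupling», reshaped engine, input (c2): THE TWO-REGION
CLUSTER TAIL OF THE HARD-CORE CELL GAS (Kotecký–Preiss estimate (4) anchored at cells)

Helper module for item `stmt-QuantumFields-19354` (`--supports … --as helper`; it closes nothing; lead prover
ym-ir-line-mxc-p1 g2).  Second input of the missing two-region mixing (c) of the OPEN engine `PolymerEngineK`
(`Theorems/IR/EsPolymerDefsK.lean`), on the tree's Kotecký–Preiss layer (`Literature/Probability/LatticeModels/ClusterExpansion*`,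
`…/LocalPerturbationClusterExpansion`).  The cell gas: polymers = cell sets connected by steps `cellDist ≤ 6` (`IsPolymer`),
incompatibility = equal or touching within `6` (`GeomInc`), activities `‖z γ‖ ≤ ε^{#γ}` vanishing off the polymers.

* `reflTransGen_biUnion_of_isPolymerCluster_geomInc` — the support of a `GeomInc R`-cluster of `R`-connected sets is
  `R`-connected (the tree's `reflTransGen_clusterSupp_of_isPolymerCluster'` for the touching incompatibility);
* `cellDist_le_of_isPolymerCluster` — hence two cells of the support of a cluster `C` of polymers are at cell distance
  `≤ 6 (‖C‖ − 1)`, `‖C‖ = ∑_{γ∈C} #γ` (`cellDist_le_mul_card_sub_one`);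
* `sum_norm_truncatedWeight_meets_both_le` (**two-region tail**): if `e^{1+τ} ε (13⁴+1)² ≤ 1/2`, `0 ≤ τ`, then for cell
  sets `E₁, E₂` at cell distance `≥ L` and any volume `Λ` of polymers containing the singletons of `E₁`,
  `∑_{C ⊆ Λ meeting E₁ and E₂} ‖Φ^T(C)‖ ≤ #E₁ · e^{−τ (L/6 + 1)}`: non-clusters have `Φ^T = 0`
  (`truncatedWeight_eq_zero_of_kp`), clusters meeting both regions have `‖C‖ ≥ L/6 + 1`, and the clusters meeting a cell `e`
  touch the polymer `{e}`, whose anchored sum `∑ ‖Φ^T(C)‖ e^{τ‖C‖} ≤ a({e}) = 1` is the tree's finite-volume estimate (4)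
  (`touchSum_le_of_kp` with `geomInc_kp_hypothesis`, `a = #·`, `d = τ #·`).

HONEST FRAMING: bookkeeping for an OPEN engine stub of a CONDITIONAL rung line; no mixing statement for observables, no
polymer representation at weak coupling and no mass gap is proved here. -/

set_option autoImplicit false

noncomputable section

open Finset
open Literature.Probability.LatticeModels (IsCompatible polymerPartitionFunction GeomInc Touches IsRConnected
  IsPolymerCluster KPTouches IsKPVolume truncatedWeight touchSum touchSum_le_of_kp geomInc_kp_hypothesis
  isKPVolume_geomInc truncatedWeight_eq_zero_of_kp)

namespace Summit.QuantumFields.YangMills.Cruxes.IR.EsPolymer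

/-! ## §1 Supports of clusters for the touching incompatibility -/

/-- **The support of a `GeomInc R`-cluster of `R`-connected sets is `R`-connected.** -/
theorem reflTransGen_biUnion_of_isPolymerCluster_geomInc {α : Type*} [DecidableEq α] {R : α → α → Prop}
    {C : Finset (Finset α)} (hCl : IsPolymerCluster (GeomInc R) C) (hconn : ∀ A ∈ C, IsRConnected R A) {v w : α}
    (hv : v ∈ C.biUnion id) (hw : w ∈ C.biUnion id) :
    Relation.ReflTransGen (fun a b => R a b ∧ a ∈ C.biUnion id ∧ b ∈ C.biUnion id) v w := by
  classical
  set Rch : α → Prop := fun u =>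
    Relation.ReflTransGen (fun a b => R a b ∧ a ∈ C.biUnion id ∧ b ∈ C.biUnion id) v u with hRch
  have hsub : ∀ A ∈ C, A ⊆ C.biUnion id := fun A hA x hx => mem_biUnion.2 ⟨A, hA, hx⟩
  -- a connected member meeting the reachable set is entirely reachable
  have hlift : ∀ A ∈ C, ∀ u ∈ A, ∀ u' ∈ A, Rch u → Rch u' := by
    intro A hA u hu u' hu' hRu
    have hpath := (hconn A hA).2 u hu u' hu'
    have hmono := Relation.ReflTransGen.mono (r := fun a b => R a b ∧ a ∈ A ∧ b ∈ A)
      (p := fun a b => R a b ∧ a ∈ C.biUnion id ∧ b ∈ C.biUnion id)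
      fun a b hab => ⟨hab.1, hsub A hA hab.2.1, hsub A hA hab.2.2⟩
    exact hRu.trans (hmono u u' hpath)
  by_contra hvw
  set C₁ : Finset (Finset α) := C.filter fun A => ∀ u ∈ A, Rch u with hC₁
  obtain ⟨A₀, hA₀, hvA₀⟩ := mem_biUnion.1 hv
  obtain ⟨A₁, hA₁, hwA₁⟩ := mem_biUnion.1 hw
  have hA₀C₁ : A₀ ∈ C₁ :=
    mem_filter.2 ⟨hA₀, fun u hu => hlift A₀ hA₀ v hvA₀ u hu Relation.ReflTransGen.refl⟩
  have hA₁C₁ : A₁ ∉ C₁ := fun h1 => hvw ((mem_filter.1 h1).2 w hwA₁)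
  obtain ⟨γ₁, hγ₁, γ₂, hγ₂, hinc⟩ := hCl C₁ (filter_subset _ _) ⟨A₀, hA₀C₁⟩ ⟨A₁, mem_sdiff.2 ⟨hA₁, hA₁C₁⟩⟩
  obtain ⟨hγ₂C, hγ₂C₁⟩ := mem_sdiff.1 hγ₂
  have hγ₁R : ∀ u ∈ γ₁, Rch u := (mem_filter.1 hγ₁).2
  rcases hinc with hEq | ⟨u, hu, u', hu', h⟩
  · exact hγ₂C₁ (hEq ▸ hγ₁)
  · have hRu' : Rch u' := by
      rcases h with rfl | h
      · exact hγ₁R u hu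
      · exact (hγ₁R u hu).tail ⟨h, hsub γ₁ (mem_filter.1 hγ₁).1 hu, hsub γ₂ hγ₂C hu'⟩
    exact hγ₂C₁ (mem_filter.2 ⟨hγ₂C, fun x hx => hlift γ₂ hγ₂C u' hu' x hx hRu'⟩)

/-- A polymer is a connected set for the step relation `cellDist ≤ 6` (tree `IsRConnected`), and conversely. -/
theorem isPolymer_iff_isRConnected {q : ℕ} (γ : Finset (Cell q)) :
    IsPolymer γ ↔ IsRConnected (fun x y : Cell q => cellDist x y ≤ 6) γ := by
  constructor
  · exact fun h => ⟨h.1, fun c hc c' hc' => Relation.ReflTransGen.mono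
      (fun x y (h : x ∈ γ ∧ y ∈ γ ∧ cellDist x y ≤ 6) => (⟨h.2.2, h.1, h.2.1⟩ : cellDist x y ≤ 6 ∧ x ∈ γ ∧ y ∈ γ))
      _ _ (h.2 c hc c' hc')⟩
  · exact fun h => ⟨h.1, fun c hc c' hc' => Relation.ReflTransGen.mono
      (fun x y (h : cellDist x y ≤ 6 ∧ x ∈ γ ∧ y ∈ γ) => (⟨h.2.1, h.2.2, h.1⟩ : x ∈ γ ∧ y ∈ γ ∧ cellDist x y ≤ 6))
      _ _ (h.2 c hc c' hc')⟩

/-- **Two cells of the support of a cluster of polymers are at cell distance `≤ 6 (‖C‖ − 1)`.** -/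
theorem cellDist_le_of_isPolymerCluster {q : ℕ} {C : Finset (Finset (Cell q))}
    (hCl : IsPolymerCluster (GeomInc fun x y : Cell q => cellDist x y ≤ 6) C) (hpoly : ∀ γ ∈ C, IsPolymer γ)
    {u v : Cell q} (hu : u ∈ C.biUnion id) (hv : v ∈ C.biUnion id) :
    cellDist u v ≤ 6 * ((∑ γ ∈ C, γ.card) - 1) := by
  classical
  have hconn : ∀ c ∈ C.biUnion id, ∀ c' ∈ C.biUnion id, Relation.ReflTransGen
      (fun x y => x ∈ C.biUnion id ∧ y ∈ C.biUnion id ∧ cellDist x y ≤ 6) c c' := fun c hc c' hc' =>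
    Relation.ReflTransGen.mono
      (fun x y (h : cellDist x y ≤ 6 ∧ x ∈ C.biUnion id ∧ y ∈ C.biUnion id) =>
        (⟨h.2.1, h.2.2, h.1⟩ : x ∈ C.biUnion id ∧ y ∈ C.biUnion id ∧ cellDist x y ≤ 6)) _ _
      (reflTransGen_biUnion_of_isPolymerCluster_geomInc hCl (fun A hA => (isPolymer_iff_isRConnected A).1 (hpoly A hA))
        hc hc')
  have h := cellDist_le_mul_card_sub_one hconn hu hv
  have hcard : (C.biUnion id).card ≤ ∑ γ ∈ C, γ.card := card_biUnion_le
  exact h.trans (Nat.mul_le_mul_left _ (by omega))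

/-! ## §2 The two-region cluster tail -/

section Tail

variable {q : ℕ}

/-- A set of polymers MEETS the cell set `E`: one of its polymers contains a cell of `E`. -/
theorem kpTouches_singleton_of_mem {C : Finset (Finset (Cell q))} {γ : Finset (Cell q)} (hγ : γ ∈ C) {e : Cell q}
    (he : e ∈ γ) : KPTouches (GeomInc fun x y : Cell q => cellDist x y ≤ 6) C {e} :=
  ⟨γ, hγ, Or.inr ⟨e, he, e, mem_singleton_self e, Or.inl rfl⟩⟩

open Classical in
/-- **The two-region cluster tail.**  For the cell gas with `‖z γ‖ ≤ ε^{#γ}` off-polymer activities `0`,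
`e^{1+τ} ε (13⁴+1)² ≤ 1/2` and `0 ≤ τ`: for cell sets `E₁, E₂` at cell distance `≥ L` and a volume `Λ` of polymers
containing the singletons of `E₁`, the truncated functionals of the sets of polymers meeting both regions sum to at most
`#E₁ · e^{−τ (L/6 + 1)}`. -/
theorem sum_norm_truncatedWeight_meets_both_le [NeZero q] {z : Finset (Cell q) → ℂ} {ε τ : ℝ} (hε : 0 ≤ ε)
    (hτ : 0 ≤ τ) (hsmall : Real.exp (1 + τ) * ε * ((13 : ℝ) ^ 4 + 1) ^ 2 ≤ 1 / 2)
    (hz0 : ∀ X, ¬ IsPolymer X → z X = 0) (hz : ∀ X, ‖z X‖ ≤ ε ^ X.card) (Λ : Finset (Finset (Cell q)))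
    (hΛ : ∀ γ ∈ Λ, IsPolymer γ) (E₁ E₂ : Finset (Cell q)) (hE₁ : ∀ e ∈ E₁, {e} ∈ Λ) {L : ℕ}
    (hL : ∀ e₁ ∈ E₁, ∀ e₂ ∈ E₂, L ≤ cellDist e₁ e₂) :
    ∑ C ∈ Λ.powerset with ((∃ γ ∈ C, (γ ∩ E₁).Nonempty) ∧ ∃ γ ∈ C, (γ ∩ E₂).Nonempty),
        ‖truncatedWeight (GeomInc fun x y : Cell q => cellDist x y ≤ 6) z C‖ ≤
      E₁.card * Real.exp (-(τ * ((L / 6 + 1 : ℕ) : ℝ))) := by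
  haveI : Std.Symm (fun x y : Cell q => cellDist x y ≤ 6) := ⟨fun x y h => by
    show cellDist y x ≤ 6; rwa [cellDist_comm]⟩
  set R : Cell q → Cell q → Prop := fun x y => cellDist x y ≤ 6 with hR
  have hRs : ∀ x y, R x y → R y x := fun x y h => by show cellDist y x ≤ 6; rw [cellDist_comm]; exact h
  set nbr : Cell q → Finset (Cell q) := fun x => Finset.univ.filter fun y : Cell q => cellDist x y ≤ 6 with hnbr
  have hΔ : ∀ x, (nbr x).card ≤ 13 ^ 4 := fun x => (card_filter_cellDist_le x 6).trans (by norm_num)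
  have hnbr' : ∀ x y, R x y → y ∈ nbr x := fun x y h => mem_filter.2 ⟨mem_univ _, h⟩
  have hz0' : ∀ X, ¬ IsRConnected R X → z X = 0 := fun X hX =>
    hz0 X fun h => hX ((isPolymer_iff_isRConnected X).1 h)
  have hcast : (((13 ^ 4 : ℕ) : ℕ) : ℝ) = (13 : ℝ) ^ 4 := by norm_num
  have hsmallτ : Real.exp (1 + τ) * ε * ((((13 ^ 4 : ℕ) : ℕ) : ℝ) + 1) ^ 2 ≤ 1 / 2 := by rwa [hcast]
  -- KP with `a = #·`, `d = τ #·` (hypothesis (1) in the volume `Λ`) and with `d = 0`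
  have h1 : ∀ X ∈ Λ, ∑ Y ∈ Λ with GeomInc R Y X, ‖z Y‖ * Real.exp ((Y.card : ℝ) + τ * (Y.card : ℝ)) ≤ (X.card : ℝ) :=
    geomInc_kp_hypothesis hRs hΔ hnbr' hε hsmallτ z hz0' hz Λ
  have hsmall0 : Real.exp 1 * ε * ((((13 ^ 4 : ℕ) : ℕ) : ℝ) + 1) ^ 2 ≤ 1 / 2 := by
    refine le_trans ?_ hsmallτ
    have : Real.exp 1 ≤ Real.exp (1 + τ) := Real.exp_le_exp.2 (by linarith)
    have h0 : 0 ≤ ε * ((((13 ^ 4 : ℕ) : ℕ) : ℝ) + 1) ^ 2 := by positivity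
    nlinarith
  have hKP : IsKPVolume (GeomInc R) z (fun X => (X.card : ℝ)) Λ := isKPVolume_geomInc hRs hΔ hnbr' hε hsmall0 z hz0' hz Λ
  -- termwise: `‖Φ^T(C)‖ ≤ e^{-τ m₀} ‖Φ^T(C)‖ e^{τ ‖C‖}` on the sets meeting both regions
  set m₀ : ℕ := L / 6 + 1 with hm₀
  have hterm : ∀ C ∈ Λ.powerset.filter (fun C => (∃ γ ∈ C, (γ ∩ E₁).Nonempty) ∧ ∃ γ ∈ C, (γ ∩ E₂).Nonempty),
      ‖truncatedWeight (GeomInc R) z C‖ ≤ Real.exp (-(τ * (m₀ : ℝ))) *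
        (‖truncatedWeight (GeomInc R) z C‖ * Real.exp (∑ γ' ∈ C, τ * (γ'.card : ℝ))) := by
    intro C hC
    obtain ⟨hCΛ, ⟨γ₁, hγ₁, u₁, hu₁⟩, ⟨γ₂, hγ₂, u₂, hu₂⟩⟩ := mem_filter.1 hC
    have hCsub : C ⊆ Λ := mem_powerset.1 hCΛ
    by_cases hΦ : truncatedWeight (GeomInc R) z C = 0
    · rw [hΦ]; simp
    · -- `C` is a cluster, so its support is connected and long
      have hCl : IsPolymerCluster (GeomInc R) C := by
        by_contra h; exact hΦ (truncatedWeight_eq_zero_of_kp hKP hCsub h)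
      obtain ⟨hu₁γ, hu₁E⟩ := mem_inter.1 hu₁
      obtain ⟨hu₂γ, hu₂E⟩ := mem_inter.1 hu₂
      have hdist := cellDist_le_of_isPolymerCluster hCl (fun γ hγ => hΛ γ (hCsub hγ))
        (mem_biUnion.2 ⟨γ₁, hγ₁, hu₁γ⟩) (mem_biUnion.2 ⟨γ₂, hγ₂, hu₂γ⟩)
      have hLd := hL u₁ hu₁E u₂ hu₂E
      have hsize : m₀ ≤ ∑ γ ∈ C, γ.card := by
        have hpos : 1 ≤ ∑ γ ∈ C, γ.card :=
          le_trans (card_pos.2 ⟨u₁, hu₁γ⟩) (single_le_sum (f := fun γ => γ.card) (fun _ _ => Nat.zero_le _) hγ₁)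
        omega
      have hexp : (1 : ℝ) ≤ Real.exp (-(τ * (m₀ : ℝ))) * Real.exp (∑ γ' ∈ C, τ * (γ'.card : ℝ)) := by
        rw [← Real.exp_add, ← mul_sum]
        refine Real.one_le_exp (by
          have : (m₀ : ℝ) ≤ ((∑ γ ∈ C, γ.card : ℕ) : ℝ) := by exact_mod_cast hsize
          push_cast at this
          nlinarith)
      calc ‖truncatedWeight (GeomInc R) z C‖ = ‖truncatedWeight (GeomInc R) z C‖ * 1 := (mul_one _).symm
        _ ≤ ‖truncatedWeight (GeomInc R) z C‖ *
            (Real.exp (-(τ * (m₀ : ℝ))) * Real.exp (∑ γ' ∈ C, τ * (γ'.card : ℝ))) :=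
          mul_le_mul_of_nonneg_left hexp (norm_nonneg _)
        _ = _ := by ring
  -- union bound over the cells of `E₁`: every set meeting `E₁` touches a singleton `{e}`, `e ∈ E₁`
  have hunion : ∑ C ∈ Λ.powerset with ((∃ γ ∈ C, (γ ∩ E₁).Nonempty) ∧ ∃ γ ∈ C, (γ ∩ E₂).Nonempty),
      ‖truncatedWeight (GeomInc R) z C‖ * Real.exp (∑ γ' ∈ C, τ * (γ'.card : ℝ)) ≤
      ∑ e ∈ E₁, touchSum (GeomInc R) z (fun γ => τ * (γ.card : ℝ)) Λ {e} := by
    unfold touchSum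
    have hR' : ∑ e ∈ E₁, ∑ C ∈ Λ.powerset with KPTouches (GeomInc R) C {e},
        ‖truncatedWeight (GeomInc R) z C‖ * Real.exp (∑ γ' ∈ C, τ * (γ'.card : ℝ)) =
        ∑ C ∈ Λ.powerset, ∑ e ∈ E₁, if KPTouches (GeomInc R) C {e} then
          ‖truncatedWeight (GeomInc R) z C‖ * Real.exp (∑ γ' ∈ C, τ * (γ'.card : ℝ)) else 0 := by
      simp_rw [sum_filter]; rw [sum_comm]
    rw [hR', sum_filter]
    refine sum_le_sum fun C _ => ?_
    have h0 : ∀ e ∈ E₁, 0 ≤ (if KPTouches (GeomInc R) C {e} then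
        ‖truncatedWeight (GeomInc R) z C‖ * Real.exp (∑ γ' ∈ C, τ * (γ'.card : ℝ)) else 0) := fun e _ => by
      split_ifs
      · exact mul_nonneg (norm_nonneg _) (Real.exp_nonneg _)
      · exact le_rfl
    split_ifs with hC
    · obtain ⟨⟨γ₁, hγ₁, u₁, hu₁⟩, -⟩ := hC
      obtain ⟨hu₁γ, hu₁E⟩ := mem_inter.1 hu₁
      have ht : KPTouches (GeomInc R) C {u₁} := kpTouches_singleton_of_mem hγ₁ hu₁γ
      calc ‖truncatedWeight (GeomInc R) z C‖ * Real.exp (∑ γ' ∈ C, τ * (γ'.card : ℝ))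
          = (if KPTouches (GeomInc R) C {u₁} then
              ‖truncatedWeight (GeomInc R) z C‖ * Real.exp (∑ γ' ∈ C, τ * (γ'.card : ℝ)) else 0) := by rw [if_pos ht]
        _ ≤ _ := single_le_sum (f := fun e => if KPTouches (GeomInc R) C {e} then
              ‖truncatedWeight (GeomInc R) z C‖ * Real.exp (∑ γ' ∈ C, τ * (γ'.card : ℝ)) else 0) h0 hu₁E
    · exact sum_nonneg h0
  -- the anchored sums are `≤ a({e}) = 1`
  have hanch : ∀ e ∈ E₁, touchSum (GeomInc R) z (fun γ => τ * (γ.card : ℝ)) Λ {e} ≤ 1 := by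
    intro e he
    have h := touchSum_le_of_kp (inc := GeomInc R) (w := z) (a := fun γ => (γ.card : ℝ))
      (d := fun γ => τ * (γ.card : ℝ)) (fun γ => Nat.cast_nonneg _) (fun γ => by positivity) h1 (hE₁ e he)
    simpa using h
  calc ∑ C ∈ Λ.powerset with ((∃ γ ∈ C, (γ ∩ E₁).Nonempty) ∧ ∃ γ ∈ C, (γ ∩ E₂).Nonempty),
        ‖truncatedWeight (GeomInc R) z C‖
      ≤ ∑ C ∈ Λ.powerset with ((∃ γ ∈ C, (γ ∩ E₁).Nonempty) ∧ ∃ γ ∈ C, (γ ∩ E₂).Nonempty),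
          Real.exp (-(τ * (m₀ : ℝ))) *
            (‖truncatedWeight (GeomInc R) z C‖ * Real.exp (∑ γ' ∈ C, τ * (γ'.card : ℝ))) := sum_le_sum hterm
    _ = Real.exp (-(τ * (m₀ : ℝ))) * ∑ C ∈ Λ.powerset with
          ((∃ γ ∈ C, (γ ∩ E₁).Nonempty) ∧ ∃ γ ∈ C, (γ ∩ E₂).Nonempty),
          ‖truncatedWeight (GeomInc R) z C‖ * Real.exp (∑ γ' ∈ C, τ * (γ'.card : ℝ)) := by rw [mul_sum]
    _ ≤ Real.exp (-(τ * (m₀ : ℝ))) * ∑ e ∈ E₁, touchSum (GeomInc R) z (fun γ => τ * (γ.card : ℝ)) Λ {e} :=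
        mul_le_mul_of_nonneg_left hunion (Real.exp_nonneg _)
    _ ≤ Real.exp (-(τ * (m₀ : ℝ))) * ∑ _e ∈ E₁, (1 : ℝ) :=
        mul_le_mul_of_nonneg_left (sum_le_sum hanch) (Real.exp_nonneg _)
    _ = E₁.card * Real.exp (-(τ * (m₀ : ℝ))) := by rw [sum_const, nsmul_eq_mul, mul_one, mul_comm]

end Tail

end Summit.QuantumFields.YangMills.Cruxes.IR.EsPolymer

end
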